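import Summits.QuantumFields.BalabanUV.Beta.FP.CoarseCovarianceStripFeynReg
import Summits.QuantumFields.BalabanUV.Beta.FP.CoarseCovarianceStripMatrix

/-!
# `BalabanUV.Beta.FP.CoarseCovarianceStripProp` — road «FP» (binder row D1), row H′2-IR ∕ IR-2 (ii), file (A): **THE HOLOMORPHIC PERFECT PROPAGATOR
# SYMBOL `PC p = (feynC p)⁻¹` ON THE CONE REGION** — for `|Im p|∞ ≤ κ₀` and `|Im p|∞ ≤ c₁·dist∞(Re p, 2πℤ^D)`, the Feynman matrix is invertible with
# `‖PC p α β‖ ≤ C_P ∕ dist∞(Re p, 2πℤ^D)²`, the constants `κ₀ = kap0 d`, `c₁ = cone d`, `C_P = CP d` depending on `d` only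

HONEST FRAMING (cell contract, verbatim): «discharging `BetaPertH` makes Bałaban's UV stability UNCONDITIONAL — a real constructive-QFT
result; it is NOT the continuum limit and NOT the Clay problem.»  HONEST DEPENDENCY (verbatim): «continuum YM on T⁴ ⇐ BetaPertH ∧ nine
spine estimates (0/9 proved); BetaPertH ⇐ (D1) ∧ (D4) ∧ CAP+tail; G-an2-4 gates asym, D1 and NE2/3/4.»  THIS MODULE DISCHARGES NOTHING of
D1 ∕ BetaPertH: [folklore] elementary complex trigonometry + finite-dimensional perturbation theory over files (W)(F)(M) of this row and the
tree's `B4StripCauchy` (`imLipschitz_of_fat`, `sin_sq_re_ge`, `jordan_sq`, `sinh_sq_le`), `PerfectPropagatorBound.re_quad_feynMat_ge` (the REAL-ZONE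
coercivity of the perfect Feynman matrix, gan24-leaf-05-g34) BY NAME.  No `def … : Prop`; nothing is cited; 0 sorry.  Nine [our object] CONSTANT
defs (`eps0`, `rhoW`, `rho0`, `cone`, `gam`, `rF`, `MF`, `kap0`, `CP`) and one data def (`redist`).  NOT summit progress; NOT BetaPertH, NOT continuum, NOT Clay.

ABSOLUTE RULE (cell, verbatim): «No internally-minted statement may enter as a cited fact. Every hypothesis is either kernel-proved in this
package or a verbatim quotation of a PUBLISHED theorem with page reference. The manuscript(s) under audit are NOT citable for their own
disputed steps — they are the thing under adjudication; programme-internal (2001/route/tribunal) claims are never citable.»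

WHY (INTENT journal l.22234; owner design memo `HOME/b2b-balaban-beta-d1-p3/H2IR-DESIGN.md` §IR-2 (ii)∕(iv)).  Every alias momentum `(k + 2πl)/n`
of a coarse momentum `k` in the thin strip lies in the cone region (its imaginary part is `Im k / n` while its real part is at distance `≥ (π−δ)/n`,
resp. `≥ |Re k|/n`, from `2πℤ^D`); this file is the uniform control of the perfect propagator symbol there.  TWO REGIMES: near `2πℤ^D`
(`dist∞ ≤ ρ₀`) the matrix is `Δ¹(p)·(1 + E)` with `Re Δ¹(p) ≥ (2/π²)·dist∞²` on the cone and `‖E‖ ≤ 1/(2D)` by CONTINUITY OF `W_∞` AT `0`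
(`W_∞(0) = 1`) — Neumann; away (`dist∞ ≥ ρ₀`) the real point is coercive (`re_quad_feynMat_ge`, floor `∝ ρ₀²`) and the entries are Lipschitz in
`Im p` by Cauchy estimates on the fat region — perturbed coercivity.

CONTENT (`D = d+1`).
* §1 `redist p := ‖Re (wrapC p)‖∞` (= `dist∞(Re p, 2πℤ^D)`), `feynC_wrapC` (the Feynman matrix only sees `p mod 2πℤ^D`), cell facts.
* §2 [folklore] `re_S1_ge` (`(4/π²)x² − (25/16)y² ≤ Re S₁(x+iy)` for `|x| ≤ π`, `|y| ≤ 1`), `sq_norm_le_sum_sq`, **`re_Delta1_ge_cone`**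
  (`(2/π²)·r² ≤ Re Δ¹(p)` for a cell point on the cone `|Im p_i| ≤ r/(4D)`, `|Im p_i| ≤ 1`, `r = ‖Re p‖∞`).
* §3 the constants and `exists_rhoW` (continuity of the periodic weight at `0`: `‖W^{per}(p) − 1‖ ≤ ε₀` for `‖p‖ < ρ_W`).
* §4 **`PC_bound_near`** (cell, `‖Re p‖∞ ≤ ρ₀`, cone): `IsUnit (feynC p).det ∧ ‖PC p α β‖ ≤ π²/‖Re p‖∞²`.
* §5–§6 (the away regime and the cone theorem `PC_bound_cone`): the sequel `FP/CoarseCovarianceStripPropCone`.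
Unit `b2b-balaban-beta-d1-formalise-leaf-06` (gen 7), owner ruling R-FP-21 (A3)∕(C).
-/

noncomputable section

namespace Summit.QuantumFields.BalabanUV.Beta.FP.CoarseCovarianceStripProp

open Filter Topology Finset Complex Set Metric Matrix
open scoped BigOperators ComplexConjugate
open Literature.MathematicalPhysics.QuantumFieldTheory.Balaban1983to89
open B4Strip (Strip ofRealVec reVec S1 S1r Sxi Delta1 S1r_ge S1r_eq)
open B4StripCauchy (Fat imLipschitz_of_fat sin_sq_re_ge jordan_sq sinh_sq_le Sxi_eq_sin_sq S1_eq_Sxi_one re_div_two_nat im_div_two_nat)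
open B4ContourShift (BZ)
open B5Prop11Fiber (d1Sym)
open B5Symbol166Strip (kappa166 kappa166_pos kappa166_le_rOf)
open Summit.QuantumFields.BalabanUV.Beta.FP.PerfectSymbol166 (W166Inf)
open Summit.QuantumFields.BalabanUV.Beta.FP.PerfectSymbol166StripReg (bound166 bound166_nonneg)
open Summit.QuantumFields.BalabanUV.Beta.FP.PerfectPropagatorSymbol (curlRow feynMat quad)
open Summit.QuantumFields.BalabanUV.Beta.FP.PerfectPropagatorBound (re_quad_feynMat_ge)
open Summit.QuantumFields.BalabanUV.Beta.FP.CoarseCovarianceAliasBF (wrapPt wrapPt_eq_self)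
open Summit.QuantumFields.BalabanUV.Beta.FP.CoarseCovarianceStripW
open Summit.QuantumFields.BalabanUV.Beta.FP.CoarseCovarianceStripWReg (continuousOn_Wper)
open Summit.QuantumFields.BalabanUV.Beta.FP.CoarseCovarianceStripFeyn
open Summit.QuantumFields.BalabanUV.Beta.FP.CoarseCovarianceStripFeynReg
open Summit.QuantumFields.BalabanUV.Beta.FP.CoarseCovarianceStripMatrix

variable {d : ℕ}

/-! ## §1 The reduced distance and reduction to the cell -/

/-- [our object] `redist p := ‖Re (wrapC p)‖∞ = dist∞(Re p, 2πℤ^D)` (sup over the coordinates of the distance of `Re p_i` to `2πℤ`). -/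
def redist (p : Fin (d + 1) → ℂ) : ℝ := ‖reVec (wrapC p)‖

/-- [folklore] `0 ≤ redist p`. -/
theorem redist_nonneg (p : Fin (d + 1) → ℂ) : 0 ≤ redist p := norm_nonneg _

/-- [folklore] each reduced coordinate is bounded by the reduced distance. -/
theorem abs_re_wrapC_le (p : Fin (d + 1) → ℂ) (i : Fin (d + 1)) : |(wrapC p i).re| ≤ redist p := by
  have h := norm_le_pi_norm (reVec (wrapC p)) i
  rw [Real.norm_eq_abs] at h
  exact h

/-- [folklore] `redist p ≤ π`. -/
theorem redist_le_pi (p : Fin (d + 1) → ℂ) : redist p ≤ Real.pi :=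
  (pi_norm_le_iff_of_nonneg Real.pi_pos.le).mpr fun i => by
    rw [Real.norm_eq_abs]; exact abs_wrapRe_re_le (p i)

/-- [folklore] the wrap is idempotent. -/
theorem wrapC_wrapC (p : Fin (d + 1) → ℂ) : wrapC (wrapC p) = wrapC p :=
  wrapC_eq_self fun i => wrapRe_re_mem (p i)

/-- [folklore] on a cell point the reduced distance is the sup norm of the real part. -/
theorem redist_of_cell {p : Fin (d + 1) → ℂ} (hp : ∀ i, (p i).re ∈ Set.Ioc (-Real.pi) Real.pi) : redist p = ‖reVec p‖ := by
  rw [redist, wrapC_eq_self hp]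

/-- [our object] **THE FEYNMAN MATRIX ONLY SEES `p mod 2πℤ^D`**: `feynC (wrapC p) = feynC p`. -/
theorem feynC_wrapC (p : Fin (d + 1) → ℂ) : feynC (wrapC p) = feynC p := by
  have hW : ∀ μ ν, Wper μ ν (wrapC p) = Wper μ ν p := fun μ ν => by rw [Wper, wrapC_wrapC]; rfl
  have h1 : d1C (wrapC p) = d1C p := d1C_wrapC p
  have h2 : d1C (-wrapC p) = d1C (-p) := by
    have e : -wrapC p = fun a => (-p) a - ((-(toIocDiv Real.two_pi_pos (-Real.pi) (p a).re) : ℤ) : ℂ) * (2 * Real.pi) := by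
      funext a
      simp only [Pi.neg_apply, wrapC_apply, wrapRe_eq_sub, Int.cast_neg]
      ring
    rw [e, d1C_sub_int]
  ext α β
  simp only [feynC, exC, hW, h1, h2]

/-! ## §2 The scalar part on the cone -/

/-- [folklore] **`(4/π²)x² − (25/16)y² ≤ Re S₁(x + iy)`** for `|x| ≤ π`, `|y| ≤ 1` (`S₁ = 4 sin²(·/2)`, `Re sin² ≥ sin²Re − sinh²Im`, Jordan, `sinh² ≤ (25/16)v²`). -/
theorem re_S1_ge {z : ℂ} (hx : |z.re| ≤ Real.pi) (hy : |z.im| ≤ 1) :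
    4 / Real.pi ^ 2 * z.re ^ 2 - 25 / 16 * z.im ^ 2 ≤ (S1 z).re := by
  rw [S1_eq_Sxi_one, Sxi_eq_sin_sq 1 one_ne_zero]
  have hre : (z / (2 * (1 : ℕ))).re = z.re / 2 := by rw [re_div_two_nat]; simp
  have him : (z / (2 * (1 : ℕ))).im = z.im / 2 := by rw [im_div_two_nat]; simp
  have h1 := sin_sq_re_ge (z / (2 * (1 : ℕ)))
  rw [hre, him] at h1
  have h2 := jordan_sq (u := z.re / 2) (by rw [abs_div, abs_two]; linarith)
  have h3 := sinh_sq_le (v := z.im / 2) (by rw [abs_div, abs_two]; linarith)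
  have e : (4 * ((1 : ℕ) : ℂ) ^ 2 * Complex.sin (z / (2 * (1 : ℕ))) ^ 2).re = 4 * (Complex.sin (z / (2 * (1 : ℕ))) ^ 2).re := by
    simp [Complex.mul_re]
  rw [e]
  nlinarith

/-- [folklore] the square of the sup norm of a real vector is at most the sum of the squares. -/
theorem sq_norm_le_sum_sq (q : Fin (d + 1) → ℝ) : ‖q‖ ^ 2 ≤ ∑ i, q i ^ 2 := by
  have h : ‖q‖ ≤ Real.sqrt (∑ i, q i ^ 2) := by
    refine (pi_norm_le_iff_of_nonneg (Real.sqrt_nonneg _)).mpr fun i => ?_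
    rw [Real.norm_eq_abs, ← Real.sqrt_sq_eq_abs]
    exact Real.sqrt_le_sqrt (Finset.single_le_sum (fun j _ => sq_nonneg (q j)) (Finset.mem_univ i))
  calc ‖q‖ ^ 2 ≤ Real.sqrt (∑ i, q i ^ 2) ^ 2 := pow_le_pow_left₀ (norm_nonneg _) h 2
    _ = ∑ i, q i ^ 2 := Real.sq_sqrt (Finset.sum_nonneg fun i _ => sq_nonneg _)

/-- [folklore] **THE SCALAR PART ON THE CONE**: for a cell point `p` (`Re p_i ∈ (−π, π]`) with `|Im p_i| ≤ ‖Re p‖∞/(4D)` and `|Im p_i| ≤ 1`,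
`(2/π²)·‖Re p‖∞² ≤ Re Δ¹(p)`. -/
theorem re_Delta1_ge_cone {p : Fin (d + 1) → ℂ} (hcell : ∀ i, (p i).re ∈ Set.Ioc (-Real.pi) Real.pi) (him1 : ∀ i, |(p i).im| ≤ 1)
    (hcone : ∀ i, |(p i).im| ≤ ‖reVec p‖ / (4 * ((d : ℝ) + 1))) :
    2 / Real.pi ^ 2 * ‖reVec p‖ ^ 2 ≤ (Delta1 0 p).re := by
  have hD : (0 : ℝ) < (d : ℝ) + 1 := by positivity
  have hπ := Real.pi_pos
  have hterm : ∀ i, 4 / Real.pi ^ 2 * (p i).re ^ 2 - 25 / 16 * (p i).im ^ 2 ≤ (S1 (p i)).re :=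
    fun i => re_S1_ge (abs_le.mpr ⟨(hcell i).1.le, (hcell i).2⟩) (him1 i)
  have hΔ : (Delta1 0 p).re = ∑ i, (S1 (p i)).re := by simp [Delta1, Complex.re_sum]
  rw [hΔ]
  have hsum : ∑ i, (4 / Real.pi ^ 2 * (p i).re ^ 2 - 25 / 16 * (p i).im ^ 2) ≤ ∑ i, (S1 (p i)).re :=
    Finset.sum_le_sum fun i _ => hterm i
  have hre : ‖reVec p‖ ^ 2 ≤ ∑ i, (p i).re ^ 2 := sq_norm_le_sum_sq (reVec p)
  have him : ∑ i, (p i).im ^ 2 ≤ ((d : ℝ) + 1) * (‖reVec p‖ / (4 * ((d : ℝ) + 1))) ^ 2 := by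
    calc ∑ i, (p i).im ^ 2 ≤ ∑ _i : Fin (d + 1), (‖reVec p‖ / (4 * ((d : ℝ) + 1))) ^ 2 :=
          Finset.sum_le_sum fun i _ => by
            have := hcone i
            rw [← sq_abs]; exact pow_le_pow_left₀ (abs_nonneg _) this 2
      _ = ((d : ℝ) + 1) * (‖reVec p‖ / (4 * ((d : ℝ) + 1))) ^ 2 := by
          simp only [Finset.sum_const, Finset.card_univ, Fintype.card_fin, nsmul_eq_mul]; push_cast; ring
  have e1 : ∑ i, (4 / Real.pi ^ 2 * (p i).re ^ 2 - 25 / 16 * (p i).im ^ 2)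
      = 4 / Real.pi ^ 2 * ∑ i, (p i).re ^ 2 - 25 / 16 * ∑ i, (p i).im ^ 2 := by
    rw [Finset.sum_sub_distrib, ← Finset.mul_sum, ← Finset.mul_sum]
  rw [e1] at hsum
  have hπ2 : 4 / Real.pi ^ 2 ≤ 1 := B4Strip.four_div_pi_sq_le_one
  have hπ9 : Real.pi ^ 2 ≤ 16 := by nlinarith [Real.pi_lt_four, Real.pi_pos]
  -- `((d+1)) * (r/(4(d+1)))² = r²/(16(d+1)) ≤ r²/16`
  have him' : ∑ i, (p i).im ^ 2 ≤ ‖reVec p‖ ^ 2 / 16 := by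
    refine him.trans ?_
    rw [div_pow, mul_pow]
    have : ((d : ℝ) + 1) * (‖reVec p‖ ^ 2 / (4 ^ 2 * ((d : ℝ) + 1) ^ 2)) = ‖reVec p‖ ^ 2 / 16 / ((d : ℝ) + 1) := by
      field_simp; ring
    rw [this]
    exact div_le_self (by positivity) (by linarith)
  have key : 2 / Real.pi ^ 2 * ‖reVec p‖ ^ 2 ≤ 4 / Real.pi ^ 2 * ‖reVec p‖ ^ 2 - 25 / 16 * (‖reVec p‖ ^ 2 / 16) := by
    have h0 : 0 ≤ ‖reVec p‖ ^ 2 := sq_nonneg _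
    have h25 : 25 / 16 / 16 ≤ 2 / Real.pi ^ 2 := by
      rw [div_le_div_iff₀ (by norm_num) (by positivity)]; nlinarith
    have h5 : 0 ≤ ‖reVec p‖ ^ 2 * (2 / Real.pi ^ 2 - 25 / 16 / 16) := mul_nonneg h0 (by linarith)
    have e : 4 / Real.pi ^ 2 * ‖reVec p‖ ^ 2 - 25 / 16 * (‖reVec p‖ ^ 2 / 16)
        = 2 / Real.pi ^ 2 * ‖reVec p‖ ^ 2 + ‖reVec p‖ ^ 2 * (2 / Real.pi ^ 2 - 25 / 16 / 16) := by ring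
    rw [e]; linarith
  calc 2 / Real.pi ^ 2 * ‖reVec p‖ ^ 2 ≤ 4 / Real.pi ^ 2 * ‖reVec p‖ ^ 2 - 25 / 16 * (‖reVec p‖ ^ 2 / 16) := key
    _ ≤ 4 / Real.pi ^ 2 * ∑ i, (p i).re ^ 2 - 25 / 16 * ∑ i, (p i).im ^ 2 := by
        have h4 : 0 ≤ 4 / Real.pi ^ 2 := by positivity
        nlinarith
    _ ≤ ∑ i, (S1 (p i)).re := hsum

/-! ## §3 The constants -/

/-- [our object] the flatness threshold `ε₀ := 1/(32π²D³)`. -/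
def eps0 (d : ℕ) : ℝ := 1 / (32 * Real.pi ^ 2 * ((d : ℝ) + 1) ^ 3)

/-- [folklore] `0 < ε₀`. -/
theorem eps0_pos (d : ℕ) : 0 < eps0 d := by unfold eps0; positivity

/-- [folklore] the periodic weight is continuous at `0`. -/
theorem continuousAt_Wper_zero {μ ν : Fin (d + 1)} (hμν : μ ≠ ν) : ContinuousAt (Wper μ ν) (0 : Fin (d + 1) → ℂ) := by
  have hmem : PStrip (d + 1) (kappa166 (d + 1)) ∈ 𝓝 (0 : Fin (d + 1) → ℂ) := by
    refine Filter.mem_of_superset (Metric.ball_mem_nhds 0 (kappa166_pos (d + 1))) fun p hp i => ?_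
    rw [mem_ball, dist_zero_right] at hp
    exact ((Complex.abs_im_le_norm (p i)).trans (norm_le_pi_norm p i)).trans hp.le
  exact (continuousOn_Wper (kappa166_pos _).le le_rfl hμν).continuousAt hmem

/-- [our object] **CONTINUITY OF `W_∞` AT `0` IN `ε₀`-FORM**: `∃ ρ > 0`, `‖p‖ < ρ ⟹ ‖W^{per}(μ,ν;p) − 1‖ ≤ ε₀` for all `μ ≠ ν`. -/
theorem exists_rhoW (d : ℕ) : ∃ ρ : ℝ, 0 < ρ ∧ ∀ p : Fin (d + 1) → ℂ, ‖p‖ < ρ →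
    ∀ μ ν : Fin (d + 1), μ ≠ ν → ‖Wper μ ν p - 1‖ ≤ eps0 d := by
  -- the finite family over the off-diagonal pairs
  set P := {x : Fin (d + 1) × Fin (d + 1) // x.1 ≠ x.2}
  set f : (Fin (d + 1) → ℂ) → P → ℂ := fun p x => Wper x.1.1 x.1.2 p with hf
  have hfc : ContinuousAt f 0 := continuousAt_pi.mpr fun x => continuousAt_Wper_zero x.2
  have hf0 : f 0 = fun _ => 1 := funext fun x => Wper_zero x.1.1 x.1.2
  obtain ⟨ρ, hρ, h⟩ := Metric.continuousAt_iff.mp hfc (eps0 d) (eps0_pos d)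
  refine ⟨ρ, hρ, fun p hp μ ν hμν => ?_⟩
  have h1 := h (by rwa [dist_zero_right])
  rw [dist_eq_norm, hf0] at h1
  have h2 := norm_le_pi_norm (f p - fun _ => 1) ⟨(μ, ν), hμν⟩
  simp only [Pi.sub_apply, hf] at h2
  exact h2.trans h1.le

/-- [our object] `ρ_W`, the radius of `exists_rhoW`. -/
def rhoW (d : ℕ) : ℝ := Classical.choose (exists_rhoW d)

/-- [folklore] `0 < ρ_W`. -/
theorem rhoW_pos (d : ℕ) : 0 < rhoW d := (Classical.choose_spec (exists_rhoW d)).1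

/-- [folklore] the defining property of `ρ_W`. -/
theorem rhoW_spec {p : Fin (d + 1) → ℂ} (hp : ‖p‖ < rhoW d) {μ ν : Fin (d + 1)} (hμν : μ ≠ ν) : ‖Wper μ ν p - 1‖ ≤ eps0 d :=
  (Classical.choose_spec (exists_rhoW d)).2 p hp μ ν hμν

/-- [our object] the near∕away threshold `ρ₀ := min (1/4) (ρ_W/4)`. -/
def rho0 (d : ℕ) : ℝ := min (1 / 4) (rhoW d / 4)

/-- [folklore] `0 < ρ₀ ≤ 1/4`, `4ρ₀ ≤ ρ_W`. -/
theorem rho0_pos (d : ℕ) : 0 < rho0 d := lt_min (by norm_num) (by linarith [rhoW_pos d])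

/-- [folklore] `ρ₀ ≤ 1/4`. -/
theorem rho0_le_quarter (d : ℕ) : rho0 d ≤ 1 / 4 := min_le_left _ _

/-- [folklore] `4ρ₀ ≤ ρ_W`. -/
theorem four_rho0_le (d : ℕ) : 4 * rho0 d ≤ rhoW d := by have := min_le_right (1 / 4 : ℝ) (rhoW d / 4); unfold rho0; linarith

/-- [our object] the cone slope `c₁ := 1/(4D)`. -/
def cone (d : ℕ) : ℝ := 1 / (4 * ((d : ℝ) + 1))

/-- [folklore] `0 < c₁ ≤ 1/4`. -/
theorem cone_pos (d : ℕ) : 0 < cone d := by unfold cone; positivity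

/-- [folklore] `c₁ ≤ 1/4`. -/
theorem cone_le_quarter (d : ℕ) : cone d ≤ 1 / 4 := by
  unfold cone
  rw [div_le_div_iff₀ (by positivity) (by norm_num)]
  have : (0 : ℝ) ≤ d := Nat.cast_nonneg d
  linarith

/-- [our object] the away coercivity floor `γ := (4/π²)^{D+2}·(4/π²)·ρ₀²`. -/
def gam (d : ℕ) : ℝ := (4 / Real.pi ^ 2) ^ (d + 1 + 2) * (4 / Real.pi ^ 2) * rho0 d ^ 2

/-- [folklore] `0 < γ`. -/
theorem gam_pos (d : ℕ) : 0 < gam d := by unfold gam; have := rho0_pos d; positivity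

/-- [folklore] `γ ≤ 1`. -/
theorem gam_le_one (d : ℕ) : gam d ≤ 1 := by
  unfold gam
  have h1 : 4 / Real.pi ^ 2 ≤ 1 := B4Strip.four_div_pi_sq_le_one
  have h0 : 0 ≤ 4 / Real.pi ^ 2 := by positivity
  have h2 : (4 / Real.pi ^ 2) ^ (d + 1 + 2) ≤ 1 := pow_le_one₀ h0 h1
  have h3 : rho0 d ^ 2 ≤ 1 := by
    have := rho0_le_quarter d; have := rho0_pos d; nlinarith
  calc (4 / Real.pi ^ 2) ^ (d + 1 + 2) * (4 / Real.pi ^ 2) * rho0 d ^ 2 ≤ 1 * 1 * 1 := by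
        gcongr
    _ = 1 := by ring

/-- [our object] the fat radius `r_F := κ₁₆₆(D)/4`. -/
def rF (d : ℕ) : ℝ := kappa166 (d + 1) / 4

/-- [folklore] `0 < r_F`, `2 r_F < κ₁₆₆`, `r_F ≤ 1/16`. -/
theorem rF_pos (d : ℕ) : 0 < rF d := by unfold rF; have := kappa166_pos (d + 1); positivity

/-- [folklore] `2 r_F < κ₁₆₆`. -/
theorem two_rF_lt (d : ℕ) : 2 * rF d < kappa166 (d + 1) := by unfold rF; have := kappa166_pos (d + 1); linarith

/-- [folklore] `r_F ≤ 1/16`. -/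
theorem rF_le (d : ℕ) : rF d ≤ 1 / 16 := by
  unfold rF; have := (kappa166_le_rOf (d + 1)).trans (B4StripCauchy.rOf_le (d + 1)); linarith

/-- [our object] the entry bound of the Feynman matrix on the fat region `M_F := 32D²·M₁₆₆ + 16`. -/
def MF (d : ℕ) : ℝ := 32 * ((d : ℝ) + 1) ^ 2 * bound166 (d + 1) + 16

/-- [folklore] `0 < M_F`. -/
theorem MF_pos (d : ℕ) : 0 < MF d := by unfold MF; have := bound166_nonneg (d + 1); positivity

/-- [our object] the strip width `κ₀ := min r_F (γ·r_F/(2D²M_F))`. -/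
def kap0 (d : ℕ) : ℝ := min (rF d) (gam d * rF d / (2 * ((d : ℝ) + 1) ^ 2 * MF d))

/-- [folklore] `0 < κ₀ ≤ r_F`, and the perturbation budget `D·(M_F/r_F·D·κ₀) ≤ γ/2`. -/
theorem kap0_pos (d : ℕ) : 0 < kap0 d := by
  unfold kap0; have := rF_pos d; have := gam_pos d; have := MF_pos d
  exact lt_min (rF_pos d) (by positivity)

/-- [folklore] `κ₀ ≤ r_F`. -/
theorem kap0_le_rF (d : ℕ) : kap0 d ≤ rF d := min_le_left _ _

/-- [folklore] the perturbation budget `D·(M_F/r_F·D·κ₀) ≤ γ/2`. -/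
theorem kap0_budget (d : ℕ) : ((d : ℝ) + 1) * (MF d / rF d * (((d : ℝ) + 1) * kap0 d)) ≤ gam d / 2 := by
  have h := min_le_right (rF d) (gam d * rF d / (2 * ((d : ℝ) + 1) ^ 2 * MF d))
  have hr := rF_pos d; have hM := MF_pos d; have hg := gam_pos d
  have hD : (0 : ℝ) < (d : ℝ) + 1 := by positivity
  have e : ((d : ℝ) + 1) * (MF d / rF d * (((d : ℝ) + 1) * kap0 d)) = kap0 d * (((d : ℝ) + 1) ^ 2 * MF d / rF d) := by ring
  rw [e]
  calc kap0 d * (((d : ℝ) + 1) ^ 2 * MF d / rF d)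
      ≤ (gam d * rF d / (2 * ((d : ℝ) + 1) ^ 2 * MF d)) * (((d : ℝ) + 1) ^ 2 * MF d / rF d) :=
        mul_le_mul_of_nonneg_right h (by positivity)
    _ = gam d / 2 := by field_simp

/-- [our object] the propagator constant `C_P := 2π²/γ`. -/
def CP (d : ℕ) : ℝ := 2 * Real.pi ^ 2 / gam d

/-- [folklore] `π² ≤ C_P` and `2/γ ≤ C_P/π²`. -/
theorem pi_sq_le_CP (d : ℕ) : Real.pi ^ 2 ≤ CP d := by
  unfold CP; rw [le_div_iff₀ (gam_pos d)]; have := gam_le_one d; nlinarith [Real.pi_pos]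

/-- [folklore] `0 < C_P`. -/
theorem CP_pos (d : ℕ) : 0 < CP d := lt_of_lt_of_le (by positivity) (pi_sq_le_CP d)

/-! ## §4 Near `2πℤ^D`: Neumann -/

/-- [our object] **NEAR THE LATTICE `2πℤ^D`**: a cell point `p` with `0 < ‖Re p‖∞ ≤ ρ₀` on the cone `|Im p_i| ≤ c₁‖Re p‖∞` has
`IsUnit (feynC p).det` and `‖PC p α β‖ ≤ π²/‖Re p‖∞²`. -/
theorem PC_bound_near {p : Fin (d + 1) → ℂ} (hcell : ∀ i, (p i).re ∈ Set.Ioc (-Real.pi) Real.pi) (hr0 : 0 < ‖reVec p‖)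
    (hr : ‖reVec p‖ ≤ rho0 d) (hcone : ∀ i, |(p i).im| ≤ cone d * ‖reVec p‖) :
    IsUnit (feynC p).det ∧ ∀ α β, ‖PC p α β‖ ≤ Real.pi ^ 2 / ‖reVec p‖ ^ 2 := by
  set r := ‖reVec p‖ with hrdef
  have hπ := Real.pi_pos
  have hD : (0 : ℝ) < (d : ℝ) + 1 := by positivity
  have hρ := rho0_le_quarter d
  have hc4 := cone_le_quarter d
  have hc0 := cone_pos d
  -- sizes of the coordinates
  have hre : ∀ i, |(p i).re| ≤ r := fun i => by
    have h := norm_le_pi_norm (reVec p) i; rw [Real.norm_eq_abs] at h; exact h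
  have him : ∀ i, |(p i).im| ≤ r / 4 := fun i => (hcone i).trans (by nlinarith [norm_nonneg (reVec p)])
  have him1 : ∀ i, |(p i).im| ≤ 1 := fun i => (him i).trans (by linarith)
  have hcone' : ∀ i, |(p i).im| ≤ ‖reVec p‖ / (4 * ((d : ℝ) + 1)) := fun i => by
    have := hcone i; unfold cone at this
    calc |(p i).im| ≤ 1 / (4 * ((d : ℝ) + 1)) * ‖reVec p‖ := this
      _ = ‖reVec p‖ / (4 * ((d : ℝ) + 1)) := by ring
  have hpi : ∀ i, ‖p i‖ ≤ 2 * r := fun i =>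
    (Complex.norm_le_abs_re_add_abs_im (p i)).trans (by linarith [hre i, him i])
  have hp1 : ∀ i, ‖p i‖ ≤ 1 := fun i => (hpi i).trans (by linarith)
  have hpn : ‖p‖ < rhoW d := by
    have h1 : ‖p‖ ≤ 2 * r := (pi_norm_le_iff_of_nonneg (by positivity)).mpr hpi
    have h2 := four_rho0_le d
    linarith
  -- the scalar part
  have hΔ : 2 / Real.pi ^ 2 * r ^ 2 ≤ (Delta1 0 p).re := re_Delta1_ge_cone hcell him1 hcone'
  have hΔpos : 0 < 2 / Real.pi ^ 2 * r ^ 2 := by positivity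
  have hΔn : 2 / Real.pi ^ 2 * r ^ 2 ≤ ‖Delta1 0 p‖ := hΔ.trans (Complex.re_le_norm _)
  have hΔ0 : Delta1 0 p ≠ 0 := fun h => by rw [h, norm_zero] at hΔn; linarith
  -- the excess
  have hv : ∀ μ ν, μ ≠ ν → ‖Wper μ ν p - 1‖ ≤ eps0 d := fun μ ν hμν => rhoW_spec hpn hμν
  have ha : ∀ μ, ‖d1C (-p) μ‖ ≤ 4 * r := fun μ => by
    have h1 : ‖(-p) μ‖ ≤ 1 := by rw [Pi.neg_apply, norm_neg]; exact hp1 μ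
    have := norm_d1C_le_two_mul h1
    rw [Pi.neg_apply, norm_neg] at this
    linarith [hpi μ]
  have hb : ∀ μ, ‖d1C p μ‖ ≤ 4 * r := fun μ => (norm_d1C_le_two_mul (hp1 μ)).trans (by linarith [hpi μ])
  have hR : ∀ α β, ‖exC (fun μ ν => Wper μ ν p - 1) p α β‖ ≤ 2 * ((d : ℝ) + 1) ^ 2 * eps0 d * (4 * r) * (4 * r) :=
    norm_exC_le (eps0_pos d).le (by positivity) (by positivity) hv ha hb
  -- `F = Δ • (1 + E)`
  set E : Matrix (Fin (d + 1)) (Fin (d + 1)) ℂ := fun α β => exC (fun μ ν => Wper μ ν p - 1) p α β / Delta1 0 p with hEdef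
  have hF : feynC p = Delta1 0 p • (1 + E) := by
    ext α β
    rw [feynC_eq_Delta1_add_exC, Matrix.smul_apply, Matrix.add_apply, Matrix.one_apply, smul_eq_mul]
    simp only [hEdef]
    have hc : Delta1 0 p * (exC (fun μ ν => Wper μ ν p - 1) p α β / Delta1 0 p) = exC (fun μ ν => Wper μ ν p - 1) p α β := by
      field_simp
    rw [mul_add, hc]
    split_ifs <;> simp
  have hE : ∀ α β, ‖E α β‖ ≤ 16 * Real.pi ^ 2 * ((d : ℝ) + 1) ^ 2 * eps0 d := by
    intro α β
    simp only [hEdef, norm_div]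
    rw [div_le_iff₀ (lt_of_lt_of_le hΔpos hΔn)]
    calc ‖exC (fun μ ν => Wper μ ν p - 1) p α β‖ ≤ 2 * ((d : ℝ) + 1) ^ 2 * eps0 d * (4 * r) * (4 * r) := hR α β
      _ = 16 * Real.pi ^ 2 * ((d : ℝ) + 1) ^ 2 * eps0 d * (2 / Real.pi ^ 2 * r ^ 2) := by field_simp; ring
      _ ≤ 16 * Real.pi ^ 2 * ((d : ℝ) + 1) ^ 2 * eps0 d * ‖Delta1 0 p‖ :=
          mul_le_mul_of_nonneg_left hΔn (by have := eps0_pos d; positivity)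
  have hDε : ((d + 1 : ℕ) : ℝ) * (16 * Real.pi ^ 2 * ((d : ℝ) + 1) ^ 2 * eps0 d) ≤ 1 / 2 := by
    unfold eps0; push_cast
    have : ((d : ℝ) + 1) * (16 * Real.pi ^ 2 * ((d : ℝ) + 1) ^ 2 * (1 / (32 * Real.pi ^ 2 * ((d : ℝ) + 1) ^ 3))) = 1 / 2 := by
      field_simp; ring
    rw [this]
  obtain ⟨hU1, hN⟩ := neumann_entry (by have := eps0_pos d; positivity) hE hDε
  obtain ⟨hU, hinv⟩ := inv_smul_eq hΔ0 hU1
  rw [← hF] at hU hinv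
  refine ⟨hU, fun α β => ?_⟩
  rw [PC, hinv, Matrix.smul_apply, smul_eq_mul, norm_mul, norm_inv]
  calc ‖Delta1 0 p‖⁻¹ * ‖(1 + E)⁻¹ α β‖ ≤ (2 / Real.pi ^ 2 * r ^ 2)⁻¹ * 2 := by
        apply mul_le_mul _ (hN α β) (norm_nonneg _) (by positivity)
        exact inv_anti₀ hΔpos hΔn
    _ = Real.pi ^ 2 / r ^ 2 := by field_simp

end Summit.QuantumFields.BalabanUV.Beta.FP.CoarseCovarianceStripProp

end
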